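import Mathlib
import Literature.Analysis.FluidPDE.Tao2016AveragedNS.WeightedLatticeFlows
import HarnessLib

/-!
# Orthant tables of Tao's cascade class: the Kamke condition in coefficients
(helper file for item stmt-NavierStokesRegularity-24639 `OrthantWake.OrthantHopWake`; `--supports`)

The route OrthantWake calls a table `α` an ORTHANT TABLE when its cascade nonlinearity is
quasi-positive (Kamke) on the cone of configurations that are `≥ 0` on the shells `≥ 1`:
`Y ≥ 0` on shells `≥ 1` and `Y_{i,n} = 0` (`n ≥ 1`) force `quadTerm δ α Y i n ≥ 0` for every
`δ > 0` — a condition quantified over ALL families `Y : Fin 4 → ℤ → ℝ → ℝ`. This file proves the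
equivalent FINITE description in terms of the structure constants on the shift set
(`orthant_iff_coefficients`):

1. every inter-shell FEED form `w ↦ Σ_{i₁i₂} α_{i₁i₂i,(0,0,1)} w_{i₁} w_{i₂}` is `≥ 0` on all of
   `ℝ⁴` (feeds into shell `1` see the signed datum shell);
2. the CROSS BACK-REACTIONS are non-negative: `α_{abi,(1,0,0)} + α_{bai,(0,1,0)} ≥ 0` whenever
   `b ≠ i` (only the diagonal `b = i` may damp);
3. every in-shell form `y ↦ Σ_{i₁i₂} α_{i₁i₂i,(0,0,0)} y_{i₁} y_{i₂}` is COPOSITIVE on the face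
   `{y ≥ 0, y_i = 0}`.

No symmetry (4.2) or cancellation (4.3) is assumed; with them, (1)–(3) say that the table is a
network of Katz–Pavlović pairs and "differential feeds" (the route's informal "KP network").
MODEL-lattice algebra only; nothing here concerns the Navier–Stokes equations, and the crux
`OrthantHopWake` is not touched.
-/

noncomputable section

-- the sub-problem namespace `NavierStokesRegularity.NavierStokesRegularity` is the tree's layout (D-0017)
set_option linter.dupNamespace false

namespace Summit.NavierStokesRegularity.NavierStokesRegularity.Theorems

open Literature.Analysis.FluidPDE.TaoCascade

/-- If `c s + d s² ≥ 0` for all `s > 0` then `c ≥ 0` (let `s ↓ 0`). [this file] -/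
theorem orthant_coeff_nonneg_of_forall_pos {c d : ℝ}
    (h : ∀ s : ℝ, 0 < s → 0 ≤ c * s + d * (s * s)) : 0 ≤ c := by
  have h' : ∀ s : ℝ, 0 < s → 0 ≤ c + d * s := fun s hs => by
    have h1 : 0 ≤ s * (c + d * s) := by nlinarith [h s hs]
    exact (mul_nonneg_iff_of_pos_left hs).1 h1
  have ht : Filter.Tendsto (fun s : ℝ => c + d * s) (nhdsWithin (0 : ℝ) (Set.Ioi 0)) (nhds c) := by
    have hc : Continuous fun s : ℝ => c + d * s := by fun_prop
    have := (hc.tendsto 0).mono_left (nhdsWithin_le_nhds (s := Set.Ioi (0 : ℝ)))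
    simpa using this
  exact ge_of_tendsto ht (eventually_nhdsWithin_of_forall fun s hs => h' s hs)

/-- **Orthant tables in coefficients.** The route's Kamke (quasi-positivity) condition on a
table `α` — for every family `Y` non-negative on shells `≥ 1`, every `δ > 0` and every mode
`(i, n)`, `n ≥ 1`, with `Y_{i,n} = 0`, the cascade nonlinearity `quadTerm δ α Y i n` is `≥ 0` — is
EQUIVALENT to three finite conditions on the structure constants on the shift set: (1) the
inter-shell feed forms `Σ α_{i₁i₂i,(0,0,1)} w_{i₁}w_{i₂}` are `≥ 0` on all of `ℝ⁴`; (2) the cross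
back-reactions `α_{abi,(1,0,0)} + α_{bai,(0,1,0)}` (`b ≠ i`) are `≥ 0`; (3) the in-shell forms
`Σ α_{i₁i₂i,(0,0,0)} y_{i₁}y_{i₂}` are copositive on the face `{y ≥ 0, y_i = 0}`. [this file] -/
theorem orthant_iff_coefficients (α : Fin 4 → Fin 4 → Fin 4 → ℤ × ℤ × ℤ → ℝ) :
    (∀ (Y : Fin 4 → ℤ → ℝ → ℝ) (τ : ℝ), (∀ (j : Fin 4) (k : ℤ), 1 ≤ k → 0 ≤ Y j k τ) →
      ∀ δ : ℝ, 0 < δ → ∀ (i : Fin 4) (n : ℤ), 1 ≤ n → Y i n τ = 0 → 0 ≤ quadTerm δ α Y i n τ) ↔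
    ((∀ (i : Fin 4) (w : Fin 4 → ℝ), 0 ≤ ∑ i₁ : Fin 4, ∑ i₂ : Fin 4, α i₁ i₂ i (0, 0, 1) * (w i₁ * w i₂)) ∧
      (∀ (i a b : Fin 4), b ≠ i → 0 ≤ α a b i (1, 0, 0) + α b a i (0, 1, 0)) ∧
      (∀ (i : Fin 4) (y : Fin 4 → ℝ), (∀ j, 0 ≤ y j) → y i = 0 →
        0 ≤ ∑ i₁ : Fin 4, ∑ i₂ : Fin 4, α i₁ i₂ i (0, 0, 0) * (y i₁ * y i₂))) := by
  constructor
  · intro hK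
    refine ⟨?_, ?_, ?_⟩
    · -- (1): test at shell 1 with the datum shell carrying `w`
      intro i w
      set Y : Fin 4 → ℤ → ℝ → ℝ := fun j l _ => if l = 0 then w j else 0 with hY
      have hYnn : ∀ (j : Fin 4) (k : ℤ), 1 ≤ k → 0 ≤ Y j k 0 := by
        intro j k hk
        simp [hY, show k ≠ 0 by omega]
      have hY1 : Y i 1 0 = 0 := by simp [hY]
      have h := hK Y 0 hYnn 1 one_pos i 1 le_rfl hY1
      rw [quadTerm_four_shifts] at h
      simpa [hY] using h
    · -- (2): test at shell 2 with `Y₂ = s e_b`, `Y₃ = e_a`, and let `s ↓ 0`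
      intro i a b hbi
      refine orthant_coeff_nonneg_of_forall_pos (d := α b b i (0, 0, 0)) fun s hs => ?_
      set Y : Fin 4 → ℤ → ℝ → ℝ := fun j l _ =>
        if l = 2 then (if j = b then s else 0) else if l = 3 then (if j = a then 1 else 0) else 0
        with hY
      have hYnn : ∀ (j : Fin 4) (k : ℤ), 1 ≤ k → 0 ≤ Y j k 0 := by
        intro j k _
        simp only [hY]
        split_ifs <;> first | exact hs.le | exact zero_le_one | exact le_rfl
      have hYi : Y i 2 0 = 0 := by simp [hY, Ne.symm hbi]
      have h := hK Y 0 hYnn 1 one_pos i 2 (by norm_num) hYi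
      rw [quadTerm_four_shifts] at h
      have hP : (0 : ℝ) < (1 + 1) ^ ((5 : ℝ) * ((2 : ℤ) : ℝ) / 2) :=
        Real.rpow_pos_of_pos (by norm_num) _
      generalize ((1 : ℝ) + 1) ^ ((5 : ℝ) * ((2 : ℤ) : ℝ) / 2) = P₁ at h hP
      generalize ((1 : ℝ) + 1) ^ ((5 : ℝ) * (((2 : ℤ) : ℝ) - 1) / 2) = P₂ at h
      norm_num [hY, Finset.sum_ite_eq', mul_ite, ite_mul, Finset.sum_add_distrib] at h
      by_contra hneg
      push Not at hneg
      have := mul_neg_of_pos_of_neg hP hneg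
      linarith
    · -- (3): test at shell 2 with `Y₂ = y`
      intro i y hy hyi
      set Y : Fin 4 → ℤ → ℝ → ℝ := fun j l _ => if l = 2 then y j else 0 with hY
      have hYnn : ∀ (j : Fin 4) (k : ℤ), 1 ≤ k → 0 ≤ Y j k 0 := by
        intro j k _
        simp only [hY]
        split_ifs
        · exact hy j
        · exact le_rfl
      have hYi : Y i 2 0 = 0 := by simp [hY, hyi]
      have h := hK Y 0 hYnn 1 one_pos i 2 (by norm_num) hYi
      rw [quadTerm_four_shifts] at h
      have hP : (0 : ℝ) < (1 + 1) ^ ((5 : ℝ) * ((2 : ℤ) : ℝ) / 2) :=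
        Real.rpow_pos_of_pos (by norm_num) _
      generalize ((1 : ℝ) + 1) ^ ((5 : ℝ) * ((2 : ℤ) : ℝ) / 2) = P₁ at h hP
      generalize ((1 : ℝ) + 1) ^ ((5 : ℝ) * (((2 : ℤ) : ℝ) - 1) / 2) = P₂ at h
      norm_num [hY] at h
      by_contra hneg
      push Not at hneg
      have := mul_neg_of_pos_of_neg hP hneg
      linarith
  · rintro ⟨h1, h2, h3⟩ Y τ hY δ hδ i n hn hYi
    rw [quadTerm_four_shifts]
    have hδ0 : 0 ≤ 1 + δ := by linarith
    have hA : 0 ≤ ∑ i₁ : Fin 4, ∑ i₂ : Fin 4, (α i₁ i₂ i (0, 0, 0) * (Y i₁ n τ * Y i₂ n τ) +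
        α i₁ i₂ i (1, 0, 0) * (Y i₁ (n + 1) τ * Y i₂ n τ) +
        α i₁ i₂ i (0, 1, 0) * (Y i₁ n τ * Y i₂ (n + 1) τ)) := by
      simp only [Finset.sum_add_distrib]
      have hQ := h3 i (fun j => Y j n τ) (fun j => hY j n hn) hYi
      have hcross : 0 ≤ ∑ i₁ : Fin 4, ∑ i₂ : Fin 4, α i₁ i₂ i (1, 0, 0) * (Y i₁ (n + 1) τ * Y i₂ n τ) +
          ∑ i₁ : Fin 4, ∑ i₂ : Fin 4, α i₁ i₂ i (0, 1, 0) * (Y i₁ n τ * Y i₂ (n + 1) τ) := by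
        have hswap : ∑ i₁ : Fin 4, ∑ i₂ : Fin 4, α i₁ i₂ i (0, 1, 0) * (Y i₁ n τ * Y i₂ (n + 1) τ) =
            ∑ a : Fin 4, ∑ b : Fin 4, α b a i (0, 1, 0) * (Y a (n + 1) τ * Y b n τ) := by
          rw [Finset.sum_comm]
          refine Finset.sum_congr rfl fun a _ => Finset.sum_congr rfl fun b _ => ?_
          ring
        rw [hswap, ← Finset.sum_add_distrib]
        refine Finset.sum_nonneg fun a _ => ?_
        rw [← Finset.sum_add_distrib]
        refine Finset.sum_nonneg fun b _ => ?_
        by_cases hb : b = i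
        · rw [hb, hYi]; simp
        · have := h2 i a b hb
          have hya : 0 ≤ Y a (n + 1) τ := hY a (n + 1) (by omega)
          have hyb : 0 ≤ Y b n τ := hY b n hn
          have : 0 ≤ (α a b i (1, 0, 0) + α b a i (0, 1, 0)) * (Y a (n + 1) τ * Y b n τ) :=
            mul_nonneg this (mul_nonneg hya hyb)
          linarith [this]
      have hQ' : 0 ≤ ∑ i₁ : Fin 4, ∑ i₂ : Fin 4, α i₁ i₂ i (0, 0, 0) * (Y i₁ n τ * Y i₂ n τ) := by
        simpa using hQ
      linarith
    have hB : 0 ≤ ∑ i₁ : Fin 4, ∑ i₂ : Fin 4, α i₁ i₂ i (0, 0, 1) * (Y i₁ (n - 1) τ * Y i₂ (n - 1) τ) :=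
      h1 i (fun j => Y j (n - 1) τ)
    exact add_nonneg (mul_nonneg (Real.rpow_nonneg hδ0 _) hA) (mul_nonneg (Real.rpow_nonneg hδ0 _) hB)

end Summit.NavierStokesRegularity.NavierStokesRegularity.Theorems

end
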